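import Summits.BirchSwinnertonDyer.BirchSwinnertonDyer.Theorems.ShaPrimaryTransferFiniteShaComponentTransferSelmerCubicCover
import Summits.BirchSwinnertonDyer.BirchSwinnertonDyer.Theorems.Rank2Observatory2DescRealSieve
import Literature.NumberTheory.EllipticCurves.TwoDescentOneRootNorm
import Literature.NumberTheory.EllipticCurves.TwoDescentOneRootRealPlace
import Literature.NumberTheory.NumberFields.NarrowClassGroup
import HarnessLib

/-!
# BirchSwinnertonDyer — the `2`-SELMER upgrade of the kernel general `2`-descent: the three-real-place sieve is
# sound on Selmer classes

HONEST FRAMING: per-curve certified instruments; no claim on BSD in rank ≥ 2. Route `ShaPrimaryTransfer`, seat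
`bsd-line-spt-p1` (g29); item T = `FiniteShaComponentTransfer` UNCHANGED; everything here `--supports` it.

Sequel of `…SelmerCubicCover` (`#Sel⁽²⁾(E/ℚ) ≤ #{admissible pairs}` given a sieve `adm` sound on Selmer classes).
Here the soundness of the three-real-place sieve `admStd3R` of the totally real kernel `2`-descent
(`Rank2Observatory2DescRealSieve.admStd3R_sound`, rational points) is re-proved for `2`-SELMER classes: for
`c ∈ Sel⁽²⁾(E/ℚ)` with Cassels class `Φ(c) = [a]`,
* the norm clause holds because `N_{K/ℚ}(a) ∈ ℚ×²` for EVERY class of `H¹(ℚ, E[2])`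
  (`WeierstrassCurve.isSquare_norm_of_kummerEquiv_oneRootDescentH1_eq`: `cor ∘ H¹(χ_θ) ∘ res = 0`);
* `ρ₁(a) > 0` at the real embedding carrying the smallest root (`rho_pos_of_mem_selmerGroup`, the archimedean local
  condition `WeierstrassCurve.pos_of_mem_selmerGroup_of_resTorsion_of_lt_roots`, read through `K_w ≃ ℝ`);
* `sign ρ₂(a) = sign ρ₃(a)` because `N(a) = ρ₁(a)ρ₂(a)ρ₃(a) > 0` (`norm_eq_prod_real_embeddings`).
Main: `admStd3R_sound_of_invariants`, **`admStd3R_sound_sel`** (= hypothesis `hadm` of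
`natCard_selmerGroup_le_of_coverSet` for a totally real cubic `2`-division field). BSD is not proved by any of
this. Sorry-free; axioms `propext`, `Classical.choice`, `Quot.sound`.
[cite: Cassels1991LecturesEllipticCurves, §15] [cite: SilvermanAEC2009, Prop. X.1.4, Prop. X.4.9]
-/

-- single-conjunct summit: `Summit.BirchSwinnertonDyer.BirchSwinnertonDyer.…` repeats the name by design
set_option linter.dupNamespace false

noncomputable section

open scoped Classical NumberField

open Literature.NumberTheory.NumberFields Literature.NumberTheory.EllipticCurves
  Literature.NumberTheory.GaloisRepresentations Polynomial Module NumberField IsDedekindDomain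
open WeierstrassCurve WeierstrassCurve.Affine

namespace Summit.BirchSwinnertonDyer.BirchSwinnertonDyer.Theorems.ShaPrimaryTransferSelmerCubicCover

open Summit.BirchSwinnertonDyer.BirchSwinnertonDyer.Rank2Observatory
open Summit.BirchSwinnertonDyer.BirchSwinnertonDyer.Rank2Observatory.TwoDescCubic

variable {K : Type} [Field K] [NumberField K] {A B C : ℤ} {θ : 𝓞 K}

/-! ## The three-real-place sieve is sound on Selmer classes -/

/-- **The norm of a totally real cubic field is the product of its three real embeddings** (distinct
`ρ₁, ρ₂, ρ₃ : K → ℝ`, `[K : ℚ] = 3`: they exhaust `K → ℂ`, Mathlib `Algebra.norm_eq_prod_embeddings`).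
[cite: Cassels1991LecturesEllipticCurves, §15 (Norm)] -/
theorem norm_eq_prod_real_embeddings (h3 : finrank ℚ K = 3) (ρ₁ ρ₂ ρ₃ : K →+* ℝ) (h12 : ρ₁ ≠ ρ₂)
    (h13 : ρ₁ ≠ ρ₃) (h23 : ρ₂ ≠ ρ₃) (z : K) :
    (Algebra.norm ℚ z : ℝ) = ρ₁ z * ρ₂ z * ρ₃ z := by
  -- the three complex embeddings `ofReal ∘ ρᵢ` are all of `K →ₐ[ℚ] ℂ`
  let e : (K →+* ℝ) → (K →ₐ[ℚ] ℂ) := fun ρ => (Complex.ofRealHom.comp ρ).toRatAlgHom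
  have he : ∀ ρ : K →+* ℝ, ∀ x, e ρ x = (ρ x : ℂ) := fun ρ x => rfl
  have hinj : ∀ {ρ ρ' : K →+* ℝ}, e ρ = e ρ' → ρ = ρ' := by
    intro ρ ρ' h
    refine RingHom.ext fun x => Complex.ofReal_injective ?_
    rw [← he, ← he, h]
  have hcard : Fintype.card (K →ₐ[ℚ] ℂ) = 3 := by rw [AlgHom.card ℚ K ℂ, h3]
  have huniv : (Finset.univ : Finset (K →ₐ[ℚ] ℂ)) = {e ρ₁, e ρ₂, e ρ₃} := by
    symm
    apply Finset.eq_univ_of_card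
    rw [Finset.card_insert_of_notMem, Finset.card_insert_of_notMem, Finset.card_singleton, hcard]
    · simp only [Finset.mem_singleton]; exact fun h => h23 (hinj h)
    · simp only [Finset.mem_insert, Finset.mem_singleton, not_or]
      exact ⟨fun h => h12 (hinj h), fun h => h13 (hinj h)⟩
  have hC : algebraMap ℚ ℂ (Algebra.norm ℚ z) = ∏ σ : K →ₐ[ℚ] ℂ, σ z := Algebra.norm_eq_prod_embeddings ℚ ℂ z
  rw [huniv, Finset.prod_insert, Finset.prod_insert, Finset.prod_singleton, he, he, he] at hC
  · apply Complex.ofReal_injective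
    have : algebraMap ℚ ℂ (Algebra.norm ℚ z) = ((Algebra.norm ℚ z : ℝ) : ℂ) := by
      rw [eq_ratCast]; norm_cast
    rw [← this, hC]; push_cast; ring
  · simp only [Finset.mem_singleton]; exact fun h => h23 (hinj h)
  · simp only [Finset.mem_insert, Finset.mem_singleton, not_or]
    exact ⟨fun h => h12 (hinj h), fun h => h13 (hinj h)⟩

/-- **Soundness of the three-real-place sieve on a class with the Selmer invariants**: if `ξ ∈ Kˣ` has
`N_{K/ℚ}(ξ) ∈ ℚ²`, `ρ₁(ξ) > 0` and `sign ρ₂(ξ) = sign ρ₃(ξ)`, then every pair `(T, U)` with `ξ·∏_T w·∏_U g ∈ K²`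
passes `admStd3R` (certified norms and sign bits). The Selmer-class form of `admStd3R_sound`.
[cite: Cassels1991LecturesEllipticCurves, §15] -/
theorem admStd3R_sound_of_invariants {m s : ℕ} (ρ₁ ρ₂ ρ₃ : K →+* ℝ)
    {w : Fin m → K} {g : Fin s → K} (hw0 : ∀ i, w i ≠ 0) (hg0 : ∀ j, g j ≠ 0)
    {Nu : Fin m → ℤ} (hNu : ∀ i, Algebra.norm ℚ (w i) = Nu i)
    {Ng : Fin s → ℤ} (hNg : ∀ j, Algebra.norm ℚ (g j) = Ng j)
    {su₁ su₂ su₃ : Fin m → Bool} {sg₁ sg₂ sg₃ : Fin s → Bool}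
    (hsu₁ : ∀ i, su₁ i = true ↔ ρ₁ (w i) < 0) (hsu₂ : ∀ i, su₂ i = true ↔ ρ₂ (w i) < 0)
    (hsu₃ : ∀ i, su₃ i = true ↔ ρ₃ (w i) < 0) (hsg₁ : ∀ j, sg₁ j = true ↔ ρ₁ (g j) < 0)
    (hsg₂ : ∀ j, sg₂ j = true ↔ ρ₂ (g j) < 0) (hsg₃ : ∀ j, sg₃ j = true ↔ ρ₃ (g j) < 0)
    {ξ : K} (hξ0 : ξ ≠ 0) (hN : IsSquare (Algebra.norm ℚ ξ)) (hρ₁ : 0 < ρ₁ ξ)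
    (hρ₂₃ : ρ₂ ξ < 0 ↔ ρ₃ ξ < 0) (T : Finset (Fin m)) (U : Finset (Fin s))
    (hsq : IsSquare (ξ * (∏ i ∈ T, w i) * ∏ j ∈ U, g j)) :
    admStd3R Nu Ng su₁ su₂ su₃ sg₁ sg₂ sg₃ T U = true := by
  set z := (∏ i ∈ T, w i) * ∏ j ∈ U, g j with hz
  have hsq' : IsSquare (ξ * z) := by rwa [hz, ← mul_assoc]
  have hz0 : z ≠ 0 := mul_ne_zero (Finset.prod_ne_zero_iff.mpr fun i _ => hw0 i)
    (Finset.prod_ne_zero_iff.mpr fun j _ => hg0 j)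
  rw [admStd3R, Bool.and_eq_true, Bool.and_eq_true, decide_eq_true_eq, decide_eq_true_eq, decide_eq_true_eq]
  have hρ1z : 0 < ρ₁ z := rho_pos_of_isSquare_mul ρ₁ hρ₁ hz0 hsq'
  have hρ₂0 : ρ₂ ξ ≠ 0 := (map_ne_zero ρ₂).mpr hξ0
  have hρ₃0 : ρ₃ ξ ≠ 0 := (map_ne_zero ρ₃).mpr hξ0
  have h2 := neg_iff_of_isSquare_mul ρ₂ hρ₂0 hz0 hsq'
  have h3' := neg_iff_of_isSquare_mul ρ₃ hρ₃0 hz0 hsq'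
  have h23z : (ρ₂ z < 0 ↔ ρ₃ z < 0) := h2.trans (hρ₂₃.trans h3'.symm)
  refine ⟨?_, ?_, ?_⟩
  · -- the norm functional: `N(z) = N(r)² / N(ξ)` is a square
    obtain ⟨r, hr⟩ := hsq'
    obtain ⟨n, hn⟩ := hN
    have hn0 : n ≠ 0 := by
      intro h0; rw [h0, mul_zero] at hn
      exact (Algebra.norm_ne_zero_iff.mpr hξ0) hn
    have hmul : Algebra.norm ℚ ξ * Algebra.norm ℚ z = Algebra.norm ℚ r * Algebra.norm ℚ r := by
      rw [← map_mul, ← map_mul, hr]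
    rw [hn] at hmul
    have hNz' : IsSquare (Algebra.norm ℚ z) := ⟨Algebra.norm ℚ r / n, by
      rw [div_mul_div_comm, eq_div_iff (mul_ne_zero hn0 hn0)]; linear_combination hmul⟩
    have hNz : Algebra.norm ℚ z = (((∏ i ∈ T, Nu i) * ∏ j ∈ U, Ng j : ℤ) : ℚ) := by
      rw [hz, map_mul, map_prod, map_prod, Finset.prod_congr rfl (fun i _ => hNu i),
        Finset.prod_congr rfl (fun j _ => hNg j)]
      push_cast
      rfl
    rw [hNz, Rat.isSquare_intCast_iff] at hNz'
    exact hNz'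
  · exact (even_card_iff_pos ρ₁ hw0 hg0 hsu₁ hsg₁ T U).mpr hρ1z
  · rw [Nat.even_add, even_card_iff_pos ρ₂ hw0 hg0 hsu₂ hsg₂ T U, even_card_iff_pos ρ₃ hw0 hg0 hsu₃ hsg₃ T U]
    exact pos_iff_pos_of_neg_iff_neg ((map_ne_zero ρ₂).mpr hz0) ((map_ne_zero ρ₃).mpr hz0) h23z

/-- **The Cassels class of a Selmer class is positive at the real embedding carrying the smallest root.**
For `E/ℚ` as above, `ρ₁ ρ₂ ρ₃ : K → ℝ` with `ρ₁(θ) < ρ₂(θ)`, `ρ₁(θ) < ρ₃(θ)`, `ρ₂(θ) ≠ ρ₃(θ)` (the three real roots of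
`F`), and `c ∈ Sel⁽²⁾(E/ℚ)` with `Φ(c) = [a]`: `0 < ρ₁(a)` (`TwoDescentOneRootRealPlace`, smallest-root regime,
read through `K_{w} ≃ ℝ` at the place `w` of `ρ₁`). [cite: SilvermanAEC2009, Prop. X.1.4 (v = ∞)]
[cite: Cassels1991LecturesEllipticCurves, §15] -/
theorem rho_pos_of_mem_selmerGroup (E : WeierstrassCurve ℚ) [E.IsElliptic] (ha₁ : E.a₁ = 0) (ha₂ : E.a₂ = A)
    (ha₃ : E.a₃ = 0) (ha₄ : E.a₄ = B) (ha₆ : E.a₆ = C)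
    (hθ : aeval (algebraMap (𝓞 K) K θ) (MonicCubic.poly A B C) = 0) [(E.baseChange K).IsElliptic]
    (ρ₁ ρ₂ ρ₃ : K →+* ℝ) (h12 : ρ₁ (algebraMap (𝓞 K) K θ) < ρ₂ (algebraMap (𝓞 K) K θ))
    (h13 : ρ₁ (algebraMap (𝓞 K) K θ) < ρ₃ (algebraMap (𝓞 K) K θ))
    (h23 : ρ₂ (algebraMap (𝓞 K) K θ) ≠ ρ₃ (algebraMap (𝓞 K) K θ))
    {c : galH1Torsion E 2} (hc : c ∈ selmerGroup E 2) (a : Kˣ)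
    (ha : kummerEquiv K 2 (E.oneRootDescentH1 K (isTwoTorsionX_of_aeval E ha₁ ha₂ ha₃ ha₄ ha₆ hθ) c) =
      Additive.ofMul (QuotientGroup.mk a)) :
    0 < ρ₁ (a : K) := by
  -- the real place of `ρ₁`
  set φ : K →+* ℂ := Complex.ofRealHom.comp ρ₁ with hφ
  have hφr : ComplexEmbedding.IsReal φ := isReal_ofRealHom_comp K ρ₁
  set w : InfinitePlace K := InfinitePlace.mk φ with hw_def
  have hw : w.IsReal := ⟨φ, hφr, rfl⟩
  have hemb : InfinitePlace.embedding_of_isReal hw = ρ₁ := embedding_of_isReal_mk_ofRealHom_comp K ρ₁ hw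
  have hread : ∀ x : K, InfinitePlace.Completion.extensionEmbeddingOfIsReal hw (algebraMap K w.Completion x) = ρ₁ x := by
    intro x
    rw [InfinitePlace.Completion.algebraMap_apply, ← hemb]
    exact InfinitePlace.Completion.extensionEmbeddingOfIsReal_coe hw (WithAbs.toAbs w.1 x)
  -- the cubic transported to `ℝ` through `K_w ≃+* ℝ` has the roots `ρ₂(θ)`, `ρ₃(θ)`
  set ψ := InfinitePlace.Completion.ringEquivRealOfIsReal hw with hψ
  have hrootR : ∀ ρ : K →+* ℝ, (((E.baseChange K).baseChange w.Completion).map ψ.toRingHom).toAffine.IsTwoTorsionX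
      (ρ (algebraMap (𝓞 K) K θ)) := by
    intro ρ
    refine ⟨?_⟩
    have hrel := MonicCubic.theta_rel hθ
    have hρ := congrArg ρ hrel
    simp only [map_add, map_mul, map_pow, map_intCast, map_zero] at hρ
    have hb2 : (((E.baseChange K).baseChange w.Completion).map ψ.toRingHom).toAffine.b₂ = 4 * (A : ℝ) := by
      show (((E.map _).map _).map _).b₂ = _
      rw [map_b₂, map_b₂, map_b₂]
      simp only [WeierstrassCurve.b₂, ha₁, ha₂, map_add, map_mul, map_pow, map_ofNat, map_zero, map_intCast]
      ring
    have hb4 : (((E.baseChange K).baseChange w.Completion).map ψ.toRingHom).toAffine.b₄ = 2 * (B : ℝ) := by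
      show (((E.map _).map _).map _).b₄ = _
      rw [map_b₄, map_b₄, map_b₄]
      simp only [WeierstrassCurve.b₄, ha₁, ha₃, ha₄, map_add, map_mul, map_ofNat, map_zero, map_intCast]
      ring
    have hb6 : (((E.baseChange K).baseChange w.Completion).map ψ.toRingHom).toAffine.b₆ = 4 * (C : ℝ) := by
      show (((E.map _).map _).map _).b₆ = _
      rw [map_b₆, map_b₆, map_b₆]
      simp only [WeierstrassCurve.b₆, ha₃, ha₆, map_add, map_mul, map_pow, map_ofNat, map_zero, map_intCast]
      ring
    rw [hb2, hb4, hb6]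
    linear_combination (4 : ℝ) * hρ
  have hθw : InfinitePlace.Completion.extensionEmbeddingOfIsReal hw (algebraMap K w.Completion (algebraMap (𝓞 K) K θ)) =
      ρ₁ (algebraMap (𝓞 K) K θ) := hread _
  have key := E.pos_of_mem_selmerGroup_of_resTorsion_of_lt_roots (isTwoTorsionX_of_aeval E ha₁ ha₂ ha₃ ha₄ ha₆ hθ)
    hc w hw (hrootR ρ₂) (hrootR ρ₃) (by rw [hθw]; exact h12) (by rw [hθw]; exact h13) h23 a ha
  rwa [hread] at key

/-- **The three-real-place sieve accepts every pair realised by a `2`-Selmer class** (= hypothesis `hadm` of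
`natCard_selmerGroup_le_of_coverSet` for a totally real `2`-division field): for `c ∈ Sel⁽²⁾(E/ℚ)` with Cassels
class `[a]` and `a·∏_T w·∏_U g ∈ K²`, `admStd3R … T U = true`. The Selmer-class form of `admStd3R_sound`: the norm
clause holds by `cor ∘ H¹(χ_θ) ∘ res = 0` (`isSquare_norm_of_kummerEquiv_oneRootDescentH1_eq`), the sign clauses
by the archimedean local condition at the place of the smallest root and `N = ρ₁ρ₂ρ₃ > 0`.
[cite: Cassels1991LecturesEllipticCurves, §15] [cite: SilvermanAEC2009, Prop. X.1.4, Prop. X.4.9] -/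
theorem admStd3R_sound_sel {m s : ℕ} (E : WeierstrassCurve ℚ) [E.IsElliptic] (ha₁ : E.a₁ = 0) (ha₂ : E.a₂ = A)
    (ha₃ : E.a₃ = 0) (ha₄ : E.a₄ = B) (ha₆ : E.a₆ = C) (hirr : Irreducible (MonicCubic.polyQ A B C))
    (hθ : aeval (algebraMap (𝓞 K) K θ) (MonicCubic.poly A B C) = 0) (h3 : finrank ℚ K = 3)
    [(E.baseChange K).IsElliptic] (ρ₁ ρ₂ ρ₃ : K →+* ℝ)
    (h12 : ρ₁ (algebraMap (𝓞 K) K θ) < ρ₂ (algebraMap (𝓞 K) K θ))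
    (h23 : ρ₂ (algebraMap (𝓞 K) K θ) < ρ₃ (algebraMap (𝓞 K) K θ))
    {w : Fin m → K} {g : Fin s → K} (hw0 : ∀ i, w i ≠ 0) (hg0 : ∀ j, g j ≠ 0)
    {Nu : Fin m → ℤ} (hNu : ∀ i, Algebra.norm ℚ (w i) = Nu i)
    {Ng : Fin s → ℤ} (hNg : ∀ j, Algebra.norm ℚ (g j) = Ng j)
    {su₁ su₂ su₃ : Fin m → Bool} {sg₁ sg₂ sg₃ : Fin s → Bool}
    (hsu₁ : ∀ i, su₁ i = true ↔ ρ₁ (w i) < 0) (hsu₂ : ∀ i, su₂ i = true ↔ ρ₂ (w i) < 0)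
    (hsu₃ : ∀ i, su₃ i = true ↔ ρ₃ (w i) < 0) (hsg₁ : ∀ j, sg₁ j = true ↔ ρ₁ (g j) < 0)
    (hsg₂ : ∀ j, sg₂ j = true ↔ ρ₂ (g j) < 0) (hsg₃ : ∀ j, sg₃ j = true ↔ ρ₃ (g j) < 0)
    {c : galH1Torsion E 2} (hc : c ∈ selmerGroup E 2) (a : Kˣ)
    (ha : kummerEquiv K 2 (E.oneRootDescentH1 K (isTwoTorsionX_of_aeval E ha₁ ha₂ ha₃ ha₄ ha₆ hθ) c) =
      Additive.ofMul (QuotientGroup.mk a))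
    (T : Finset (Fin m)) (U : Finset (Fin s))
    (hsq : IsSquare ((a : K) * (∏ i ∈ T, w i) * ∏ j ∈ U, g j)) :
    admStd3R Nu Ng su₁ su₂ su₃ sg₁ sg₂ sg₃ T U = true := by
  have hθ' := isTwoTorsionX_of_aeval E ha₁ ha₂ ha₃ ha₄ ha₆ hθ
  -- the three Selmer invariants of `a`
  have hN : IsSquare (Algebra.norm ℚ (a : K)) :=
    E.isSquare_norm_of_kummerEquiv_oneRootDescentH1_eq (irreducible_twoDivision E ha₁ ha₂ ha₃ ha₄ ha₆ hirr) h3 hθ' c a ha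
  have hρ₁ : 0 < ρ₁ (a : K) :=
    rho_pos_of_mem_selmerGroup E ha₁ ha₂ ha₃ ha₄ ha₆ hθ ρ₁ ρ₂ ρ₃ h12 (h12.trans h23) (ne_of_lt h23) hc a ha
  have hρ12 : ρ₁ ≠ ρ₂ := fun h => (ne_of_lt h12) (by rw [h])
  have hρ13 : ρ₁ ≠ ρ₃ := fun h => (ne_of_lt (h12.trans h23)) (by rw [h])
  have hρ23 : ρ₂ ≠ ρ₃ := fun h => (ne_of_lt h23) (by rw [h])
  have hρ₂₃ : ρ₂ (a : K) < 0 ↔ ρ₃ (a : K) < 0 := by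
    -- `N(a) = ρ₁(a) ρ₂(a) ρ₃(a) = n² > 0`
    obtain ⟨n, hn⟩ := hN
    have hn0 : n ≠ 0 := by
      intro h0; rw [h0, mul_zero] at hn
      exact (Algebra.norm_ne_zero_iff.mpr a.ne_zero) hn
    have hpos : 0 < ρ₁ (a : K) * ρ₂ (a : K) * ρ₃ (a : K) := by
      rw [← norm_eq_prod_real_embeddings h3 ρ₁ ρ₂ ρ₃ hρ12 hρ13 hρ23, hn]
      push_cast
      have : (n : ℝ) ≠ 0 := by exact_mod_cast hn0
      exact mul_self_pos.mpr this
    have h23pos : 0 < ρ₂ (a : K) * ρ₃ (a : K) := by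
      rw [mul_assoc] at hpos
      exact pos_of_mul_pos_right hpos hρ₁.le
    constructor
    · intro h2
      by_contra h3n
      have h3p : 0 < ρ₃ (a : K) := lt_of_le_of_ne (not_lt.mp h3n) (((map_ne_zero ρ₃).mpr a.ne_zero).symm)
      linarith [mul_neg_of_neg_of_pos h2 h3p]
    · intro h3
      by_contra h2n
      have h2p : 0 < ρ₂ (a : K) := lt_of_le_of_ne (not_lt.mp h2n) (((map_ne_zero ρ₂).mpr a.ne_zero).symm)
      linarith [mul_neg_of_pos_of_neg h2p h3]
  exact admStd3R_sound_of_invariants ρ₁ ρ₂ ρ₃ hw0 hg0 hNu hNg hsu₁ hsu₂ hsu₃ hsg₁ hsg₂ hsg₃ a.ne_zero hN hρ₁ hρ₂₃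
    T U hsq

end Summit.BirchSwinnertonDyer.BirchSwinnertonDyer.Theorems.ShaPrimaryTransferSelmerCubicCover

end
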